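import Literature.MathematicalPhysics.QuantumFieldTheory.Balaban1983to89.B13Factor210Literal
import Literature.MathematicalPhysics.QuantumFieldTheory.Balaban1983to89.TreeLengthCubeSystem
import Literature.MathematicalPhysics.QuantumFieldTheory.Balaban1983to89.B13Sect2Statements

/-!
# `Balaban1983to89.B13Eq210Components` — T. Bałaban, *Renormalization group approach to lattice gauge field
theories. II. Cluster expansions*, Commun. Math. Phys. **116** (1988) 1–22 [Balaban1988RG2Cluster]: the FIRST
EQUALITY of (2.11) p. 14 from (2.9)–(2.10) — the bijection «Z ↦ its connected components» — PROVED for the window geometry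

HONEST FRAMING (cell `lit-balaban`, verbatim): statement-level skeleton of published theorems with citation tags; proofs where landed; nothing here is a claim about the Yang–Mills mass gap.

PDF held: `paper:balaban1988-cmp116-rg-ii-cluster` (journal page = PDF page + 0); p. 14 read as an image from
`run/shared/lean/pub/pub-balaban/b2b-balaban-ref1/pages/1988-cmp116-rg-II-cluster/1988-cmp116-rg-II-cluster-p014-x2.png`.

CITATION HEADER (p. 14, verbatim): *"(2.1) = Σ_Z H(Z), where H(Z) = Σ_{Z₀: Z̃₀⊂Z} H(Z, Z₀). (2.9) … From the
definition of H(Z) it is also clear, that if Z = Z₁ ∪ … ∪ Z_n, where Z_i is a connected component of Z, then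
H(Z) = H(Z₁) … H(Z_n). (2.10) Thus finally we obtain the polymer expansion (2.1) = Σ_{{Z₁,…,Z_n}} H(Z₁)⋯H(Z_n) =
1 + Σ_{n=1}^∞ (1/n!) Σ_{(Z₁,…,Z_n)} Π_{{i,j},i<j} ζ(Z_i, Z_j)H(Z₁)⋯H(Z_n), (2.11) where the function ζ(Z, Z′) is
defined by the condition: ζ(Z, Z′) = 0 if Z∩Z′ contains a cube, or a wall of a cube, and ζ(Z, Z′) = 1 otherwise."*
Connectedness is that of [Balaban1987RG1] p. 257 (*"two consecutive cubes have a common wall"*).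

WHAT IS REPRODUCED (unit `lit-balaban-p25`, Phase-2 seat p25 of `run/shared/lean/pub/lit-balaban/PHASE2-TARGETS.md`
§G.3; SKELETON row `B13.Eq2.10`, knitting `B13.Eq2.9`/`B13.Eq2.11`).  The step Σ_Z Π_i H(Z_i) = Σ_{{Z₁,…,Z_n}} Π H(Z_i)
between (2.10) and the first sum of (2.11) is the bijection `Z ↦ {connected components of Z}`, inverse
`{Z₁,…,Z_n} ↦ ⋃ Z_i`, between the families `Z` of cubes of a finite window `B` and the pairwise ζ-compatible
families of localization domains of `B`.  Proved over the tree's CONCRETE index geometry, with the existing typings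
of the printed notions BRIDGED, none re-declared: (A) `B13ScaleTransfer.Adj` ↔ `B14Components.WallAdjacent`,
`B13ScaleTransfer.FaceConnected` ↔ `B13Factor210.WallConnected`, `¬ TreeLengthCubeSystem.Touch` ↔
`B13Factor210.WallSeparated` (ζ = 1); (B) `compsF Z` = the wall-components of a finite family, `Z = ⋃ compsF Z`,
pairwise ζ-compatible, and the inverse law `compsF (⋃ F) = F` (`compsF_biUnion`); (C) `Σ_{Z⊆B} Π_{K ∈ compsF Z} H K =
Σ_{F ∈ polymerFamilies B} Π_{K∈F} H K` for EVERY `H` (`sum_powerset_prod_comps`), re-indexed by the finite type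
`TreeLengthCubeSystem.Dom B` as `polymerPartitionFunction (Touch B) H univ` (tree's set form, `first_eq_211`),
`B13Sect2Statements.compatibleFamilySum (zeta B) H` (printed family form, `first_eq_211_printed`) and
`B13Sect2Statements.polymerSeries211 (zeta B) H` (both equalities of (2.11), `polymerExpansion_211_window`);
(D) composed with (2.9)–(2.10) as landed (`B13Factor210.Hsum_biUnion`, `B13Factor210Literal.HsumLit_biUnion`):
Σ_{Z⊆B} H(Z) = Σ_{{Z₁,…,Z_n}} Π H(Z_i) (`sum_Hsum_eq_sum_polymerFamilies`, `sum_Hsum_eq_Z`, `sum_HsumLit_eq_…`).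
NOT ASSERTED: anything analytic (`H(Z, Z₀)` abstract as in `B13Factor210`); the window is a finite subset of ℤ^d with
free boundary (`TreeLengthCubeSystem`), not the torus; no new `Prop` fact (D-0026). HOME `…/lit-balaban/lit-balaban-p25/`.
-/

namespace Literature.MathematicalPhysics.QuantumFieldTheory.Balaban1983to89.B13Eq210Components

open Literature.MathematicalPhysics.QuantumFieldTheory.Balaban1983to89.B14DomainGeom
open Literature.MathematicalPhysics.QuantumFieldTheory.Balaban1983to89.B14Components
open Literature.MathematicalPhysics.QuantumFieldTheory.Balaban1983to89.B14BoxFixWall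
open Literature.MathematicalPhysics.QuantumFieldTheory.Balaban1983to89.B13Factor210
open Literature.MathematicalPhysics.QuantumFieldTheory.Balaban1983to89.B13Factor210Literal
open Literature.MathematicalPhysics.QuantumFieldTheory.Balaban1983to89.B13ScaleTransfer
  (Adj StepIn Linked FaceConnected)
open Literature.MathematicalPhysics.QuantumFieldTheory.Balaban1983to89.TreeLengthCubeSystem
  (IsDom Dom mem_cellsOf Touch touch_refl touch_symm)
open Literature.MathematicalPhysics.QuantumFieldTheory.Balaban1983to89.B13Sect2Statements
  (Compatible compatibleFamilySum polymerSeries211 polymerExpansion_211)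
open Literature.Probability.LatticeModels
  (IsCompatible polymerPartitionFunction polymerPartitionFunction_eq_sum_filter)

variable {d : ℕ}

/-! ## Part A. Bridges between the tree's typings of «common wall», «connected», «ζ» -/

/-- The two index-level typings of *"two consecutive cubes have a common wall"* agree: `B13ScaleTransfer.Adj`
(y = x ± e_i) ↔ `B14Components.WallAdjacent` (one coordinate differs, by 1). [cite: Balaban1987RG1, p.257] -/
theorem adj_iff_wallAdjacent {x y : Pt d} : Adj x y ↔ WallAdjacent x y := by
  constructor
  · rintro ⟨i, rfl | rfl⟩
    · refine ⟨i, ?_, fun j hj => ?_⟩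
      · rw [Function.update_self, show x i - (x i + 1) = -1 by ring, abs_neg, abs_one]
      · rw [Function.update_of_ne hj]
    · refine ⟨i, ?_, fun j hj => ?_⟩
      · rw [Function.update_self, show y i + 1 - y i = 1 by ring, abs_one]
      · rw [Function.update_of_ne hj]
  · rintro ⟨i, hi, hrest⟩
    have key : ∀ {u v : Pt d}, u i = v i + 1 → (∀ j, j ≠ i → u j = v j) → u = Function.update v i (v i + 1) :=
      fun hi' hr => funext fun j => by
        by_cases hj : j = i
        · rw [hj, Function.update_self, hi']
        · rw [Function.update_of_ne hj, hr j hj]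
    rcases (abs_eq zero_le_one).1 hi with h1 | h1
    · exact ⟨i, Or.inr (key (by linarith) hrest)⟩
    · exact ⟨i, Or.inl (key (by linarith) fun j hj => (hrest j hj).symm)⟩

/-- One chain step: `B13ScaleTransfer.StepIn S = B14Components.WStep ↑S`. [folklore] -/
private theorem stepIn_eq_wStep (S : Finset (Pt d)) : StepIn S = WStep (↑S : Set (Pt d)) := by
  funext x y
  apply propext
  simp only [StepIn, WStep, Finset.mem_coe, adj_iff_wallAdjacent]

/-- Chains of common-wall steps: `B13ScaleTransfer.Linked S` ↔ `B14Components.WConn ↑S`. [cite: Balaban1987RG1, p.257] -/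
theorem linked_iff_wConn {S : Finset (Pt d)} {a b : Pt d} : Linked S a b ↔ WConn (↑S : Set (Pt d)) a b := by
  unfold Linked WConn
  rw [stepIn_eq_wStep]

/-- *"A connected family"*: `B13ScaleTransfer.FaceConnected S` ↔ `B13Factor210.WallConnected ↑S`. [cite: Balaban1987RG1, p.257] -/
theorem faceConnected_iff_wallConnected {S : Finset (Pt d)} :
    FaceConnected S ↔ WallConnected (↑S : Set (Pt d)) := by
  simp only [FaceConnected, WallConnected, Finset.mem_coe, linked_iff_wConn]

/-! ## Part B. The connected components of a finite family of cubes, as a finite family -/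

open Classical in
/-- The connected component of the cube `a` in the finite family `Z` (the `Z_i ∋ a` of (2.10)). [cite: Balaban1988RG2Cluster, (2.10) p.14] -/
noncomputable def compF (Z : Finset (Pt d)) (a : Pt d) : Finset (Pt d) :=
  Z.filter fun b => WConn (↑Z : Set (Pt d)) a b

/-- The family `{Z₁,…,Z_n}` of the connected components of `Z` (2.10). [cite: Balaban1988RG2Cluster, (2.10) p.14] -/
noncomputable def compsF (Z : Finset (Pt d)) : Finset (Finset (Pt d)) := Z.image (compF Z)

/-- Membership in a component. [cite: Balaban1988RG2Cluster, (2.10) p.14] -/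
theorem mem_compF {Z : Finset (Pt d)} {a b : Pt d} : b ∈ compF Z a ↔ b ∈ Z ∧ WConn (↑Z : Set (Pt d)) a b := by
  classical exact Finset.mem_filter

/-- A component is a sub-family. [cite: Balaban1988RG2Cluster, (2.10) p.14] -/
theorem compF_subset (Z : Finset (Pt d)) (a : Pt d) : compF Z a ⊆ Z := fun _ hb => (mem_compF.1 hb).1

/-- A cube lies in its component. [cite: Balaban1988RG2Cluster, (2.10) p.14] -/
theorem mem_compF_self {Z : Finset (Pt d)} {a : Pt d} (ha : a ∈ Z) : a ∈ compF Z a :=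
  mem_compF.2 ⟨ha, Relation.ReflTransGen.refl⟩

/-- `compF` IS the tree's wall-component `B14Components.wComp` (finite form). [cite: Balaban1988RG2Cluster, (2.10) p.14] -/
theorem coe_compF {Z : Finset (Pt d)} {a : Pt d} (ha : a ∈ Z) :
    (↑(compF Z a) : Set (Pt d)) = wComp (↑Z : Set (Pt d)) a := by
  ext b
  simp only [Finset.mem_coe, mem_compF, wComp, Set.mem_setOf_eq]
  exact ⟨fun h => h.2, fun h => ⟨Finset.mem_coe.1 (wComp_subset (Finset.mem_coe.2 ha) h), h⟩⟩

/-- Components of a family of cubes of the window `B` are localization domains of `B` (`TreeLengthCubeSystem.IsDom`: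
inside `B`, non-empty, connected). [cite: Balaban1988RG2Cluster, (2.10) p.14] -/
theorem isDom_compF {B Z : Finset (Pt d)} (hZB : Z ⊆ B) {a : Pt d} (ha : a ∈ Z) : IsDom B (compF Z a) := by
  refine ⟨(compF_subset Z a).trans hZB, ⟨a, mem_compF_self ha⟩, faceConnected_iff_wallConnected.2 ?_⟩
  rw [coe_compF ha]
  exact wallConnected_wComp _ a

/-- Membership in the family of components. [cite: Balaban1988RG2Cluster, (2.10) p.14] -/
theorem mem_compsF {Z : Finset (Pt d)} {K : Finset (Pt d)} : K ∈ compsF Z ↔ ∃ a ∈ Z, compF Z a = K :=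
  Finset.mem_image

/-- Distinct components are ζ-COMPATIBLE (`B13Factor210.WallSeparated`). [cite: Balaban1988RG2Cluster, (2.11) p.14] -/
theorem compsF_pairwise (Z : Finset (Pt d)) :
    (↑(compsF Z) : Set (Finset (Pt d))).Pairwise fun K K' => WallSeparated (↑K : Set (Pt d)) ↑K' := by
  intro K hK K' hK' hne
  obtain ⟨a, ha, rfl⟩ := mem_compsF.1 (Finset.mem_coe.1 hK)
  obtain ⟨b, hb, rfl⟩ := mem_compsF.1 (Finset.mem_coe.1 hK')
  rw [coe_compF ha, coe_compF hb]
  exact wComp_wallSeparated (Finset.mem_coe.2 ha) (Finset.mem_coe.2 hb) fun h =>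
    hne (Finset.coe_injective ((coe_compF ha).trans (h.trans (coe_compF hb).symm)))

/-- `Z = Z₁ ∪ … ∪ Z_n` (2.10): a family is the union of its components. [cite: Balaban1988RG2Cluster, (2.10) p.14] -/
theorem biUnion_compsF (Z : Finset (Pt d)) : (compsF Z).biUnion id = Z := by
  ext b
  simp only [Finset.mem_biUnion, id, mem_compsF]
  constructor
  · rintro ⟨K, ⟨a, _, rfl⟩, hb⟩; exact compF_subset Z a hb
  · intro hb; exact ⟨compF Z b, ⟨b, hb, rfl⟩, mem_compF_self hb⟩

/-- INVERSE LAW: for connected, pairwise ζ-compatible `Z₁,…,Z_n`, the component of `⋃ Z_i` through a cube of `Z_i`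
is `Z_i` (`B13Factor210.WallConnected.subset_piece`). [cite: Balaban1988RG2Cluster, (2.11) p.14] -/
theorem compF_biUnion_eq {F : Finset (Finset (Pt d))} (hconn : ∀ K ∈ F, WallConnected (↑K : Set (Pt d)))
    (hsep : (↑F : Set (Finset (Pt d))).Pairwise fun K K' => WallSeparated (↑K : Set (Pt d)) ↑K')
    {K : Finset (Pt d)} (hK : K ∈ F) {a : Pt d} (ha : a ∈ K) : compF (F.biUnion id) a = K := by
  have haU : a ∈ F.biUnion id := Finset.mem_biUnion.2 ⟨K, hK, ha⟩
  apply Finset.coe_injective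
  rw [coe_compF haU]
  apply Set.Subset.antisymm
  · refine (wallConnected_wComp _ a).subset_piece (I := F) (Z := fun K => (↑K : Set (Pt d))) ?_ hsep
      (mem_wComp_self _ a) hK (Finset.mem_coe.2 ha)
    intro x hx
    obtain ⟨K', hK', hxK'⟩ := Finset.mem_biUnion.1 (Finset.mem_coe.1 (wComp_subset (Finset.mem_coe.2 haU) hx))
    exact Set.mem_iUnion₂.2 ⟨K', hK', Finset.mem_coe.2 hxK'⟩
  · exact (hconn K hK).subset_wComp
      (fun x hx => Finset.mem_coe.2 (Finset.mem_biUnion.2 ⟨K, hK, Finset.mem_coe.1 hx⟩)) (Finset.mem_coe.2 ha)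

/-- The components of `Z₁ ∪ … ∪ Z_n` are exactly `Z₁, …, Z_n` (non-empty, connected, pairwise ζ-compatible):
«family ↦ union» is a right inverse of «Z ↦ components». [cite: Balaban1988RG2Cluster, (2.11) p.14] -/
theorem compsF_biUnion {F : Finset (Finset (Pt d))} (hne : ∀ K ∈ F, K.Nonempty)
    (hconn : ∀ K ∈ F, WallConnected (↑K : Set (Pt d)))
    (hsep : (↑F : Set (Finset (Pt d))).Pairwise fun K K' => WallSeparated (↑K : Set (Pt d)) ↑K') :
    compsF (F.biUnion id) = F := by
  ext K
  rw [mem_compsF]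
  constructor
  · rintro ⟨a, haU, rfl⟩
    obtain ⟨K', hK', haK'⟩ := Finset.mem_biUnion.1 haU
    rw [compF_biUnion_eq hconn hsep hK' haK']
    exact hK'
  · intro hK
    obtain ⟨a, ha⟩ := hne K hK
    exact ⟨a, Finset.mem_biUnion.2 ⟨K, hK, ha⟩, compF_biUnion_eq hconn hsep hK ha⟩

/-! ## Part C. The families `{Z₁,…,Z_n}` of (2.11) for a window and the bijection identity -/

open Classical in
/-- The families `{Z₁,…,Z_n}` of the first sum of (2.11) for the window `B`: finite sets of localization domains of
`B` (`TreeLengthCubeSystem.IsDom`: inside `B`, non-empty, connected), pairwise ζ-compatible (the empty family gives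
the printed `1`). [cite: Balaban1988RG2Cluster, (2.11) p.14] -/
noncomputable def polymerFamilies (B : Finset (Pt d)) : Finset (Finset (Finset (Pt d))) :=
  B.powerset.powerset.filter fun F => (∀ K ∈ F, IsDom B K) ∧
    (↑F : Set (Finset (Pt d))).Pairwise fun K K' => WallSeparated (↑K : Set (Pt d)) ↑K'

/-- Membership in `polymerFamilies`. [cite: Balaban1988RG2Cluster, (2.11) p.14] -/
theorem mem_polymerFamilies {B : Finset (Pt d)} {F : Finset (Finset (Pt d))} :
    F ∈ polymerFamilies B ↔ (∀ K ∈ F, IsDom B K) ∧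
      (↑F : Set (Finset (Pt d))).Pairwise fun K K' => WallSeparated (↑K : Set (Pt d)) ↑K' := by
  classical
  rw [polymerFamilies, Finset.mem_filter, and_iff_right_of_imp]
  exact fun h => Finset.mem_powerset.2 fun K hK => Finset.mem_powerset.2 (h.1 K hK).1

/-- The components of a family of cubes of `B` form a family of (2.11). [cite: Balaban1988RG2Cluster, (2.11) p.14] -/
theorem compsF_mem_polymerFamilies {B Z : Finset (Pt d)} (hZB : Z ⊆ B) : compsF Z ∈ polymerFamilies B := by
  refine mem_polymerFamilies.2 ⟨fun K hK => ?_, compsF_pairwise Z⟩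
  obtain ⟨a, ha, rfl⟩ := mem_compsF.1 hK
  exact isDom_compF hZB ha

section Identity

variable {R : Type*} [CommSemiring R]

/-- **(2.10) ⇒ first sum of (2.11), THE BIJECTION** `Z ↦ {components of Z}` / `{Z₁,…,Z_n} ↦ ⋃ Z_i`:
`Σ_{Z ⊆ B} Π_{Z_i component of Z} H(Z_i) = Σ_{{Z₁,…,Z_n}} H(Z₁)⋯H(Z_n)` for EVERY `H`. [cite: Balaban1988RG2Cluster, (2.11) p.14] -/
theorem sum_powerset_prod_comps (B : Finset (Pt d)) (H : Finset (Pt d) → R) :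
    ∑ Z ∈ B.powerset, ∏ K ∈ compsF Z, H K = ∑ F ∈ polymerFamilies B, ∏ K ∈ F, H K := by
  refine Finset.sum_nbij' compsF (fun F => F.biUnion id) ?_ ?_ ?_ ?_ fun _ _ => rfl
  · intro Z hZ
    exact compsF_mem_polymerFamilies (Finset.mem_powerset.1 hZ)
  · intro F hF
    exact Finset.mem_powerset.2 (Finset.biUnion_subset.2 fun K hK => (mem_polymerFamilies.1 hF).1 K hK |>.1)
  · intro Z _
    exact biUnion_compsF Z
  · intro F hF
    obtain ⟨hdom, hsep⟩ := mem_polymerFamilies.1 hF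
    exact compsF_biUnion (fun K hK => (hdom K hK).2.1)
      (fun K hK => faceConnected_iff_wallConnected.1 (hdom K hK).2.2) hsep

/-- (2.10) for the component decomposition, as landed in `B13Factor210` (`AdmLocal`, `ActMul`, `H(∅) = 1`):
`H(Z) = Π_{K component of Z} H(K)`. [cite: Balaban1988RG2Cluster, (2.10) p.14] -/
theorem Hsum_eq_prod_compsF {adm : Finset (Pt d) → Finset (Pt d) → Prop} [∀ Z Z₀, Decidable (adm Z Z₀)]
    {act : Finset (Pt d) → Finset (Pt d) → R} (hadm : AdmLocal adm) (hact : ActMul adm act)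
    (h0 : Hsum adm act ∅ = 1) (Z : Finset (Pt d)) : Hsum adm act Z = ∏ K ∈ compsF Z, Hsum adm act K := by
  have h := Hsum_biUnion hadm hact h0 id (compsF Z) (compsF_pairwise Z)
  rwa [biUnion_compsF] at h

/-- **(2.9)–(2.10) ⇒ (2.11), first equality** over `B13Factor210.Hsum` (given `AdmLocal`, `ActMul`, `H(∅) = 1`):
`Σ_{Z ⊆ B} H(Z) = Σ_{{Z₁,…,Z_n}} H(Z₁)⋯H(Z_n)`. [cite: Balaban1988RG2Cluster, (2.11) p.14] -/
theorem sum_Hsum_eq_sum_polymerFamilies {adm : Finset (Pt d) → Finset (Pt d) → Prop}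
    [∀ Z Z₀, Decidable (adm Z Z₀)] {act : Finset (Pt d) → Finset (Pt d) → R} (hadm : AdmLocal adm)
    (hact : ActMul adm act) (h0 : Hsum adm act ∅ = 1) (B : Finset (Pt d)) :
    ∑ Z ∈ B.powerset, Hsum adm act Z = ∑ F ∈ polymerFamilies B, ∏ K ∈ F, Hsum adm act K := by
  rw [← sum_powerset_prod_comps B (Hsum adm act)]
  exact Finset.sum_congr rfl fun Z _ => Hsum_eq_prod_compsF hadm hact h0 Z

/-- The same over the LITERAL two-scale admissibility condition (`B13Factor210Literal.HsumLit`, `L ≥ 1`), given only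
the multiplicativity shape `ActMulLit` and `H(∅, ∅) = 1`. [cite: Balaban1988RG2Cluster, (2.11) p.14] -/
theorem sum_HsumLit_eq_sum_polymerFamilies {L : ℕ} (hL : 0 < L) [∀ Z Z₀ : Finset (Pt d), Decidable (AdmLit L Z Z₀)]
    {act : Finset (Pt d) → Finset (Pt d) → R} (hact : ActMulLit L act) (h0 : act ∅ ∅ = 1) (B : Finset (Pt d)) :
    ∑ Z ∈ B.powerset, HsumLit L act Z = ∑ F ∈ polymerFamilies B, ∏ K ∈ F, HsumLit L act K := by
  rw [← sum_powerset_prod_comps B (HsumLit L act)]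
  refine Finset.sum_congr rfl fun Z _ => ?_
  have h := HsumLit_biUnion hL hact h0 id (compsF Z) (compsF_pairwise Z)
  rwa [biUnion_compsF] at h

end Identity

/-! ## Part D. Re-indexing by the finite type of localization domains: the tree's set form and the printed form -/

section Window

variable (B : Finset (Pt d))

/-- `ζ(Z, Z′) = 1` — the negation of the incompatibility `TreeLengthCubeSystem.Touch` (*"Z ∩ Z′ contains a cube, or a
wall of a cube"*) — is `B13Factor210.WallSeparated` of the underlying families. [cite: Balaban1988RG2Cluster, (2.11) p.14] -/
theorem not_touch_iff_wallSeparated (Z Z' : Dom B) :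
    ¬ Touch B Z Z' ↔ WallSeparated (↑Z.1 : Set (Pt d)) ↑Z'.1 := by
  constructor
  · intro hT a ha b hb
    refine ⟨fun hab => hT ?_, fun hadj => hT ?_⟩ <;>
      refine ⟨⟨a, Z.2.1 (Finset.mem_coe.1 ha)⟩, mem_cellsOf.2 (Finset.mem_coe.1 ha),
        ⟨b, Z'.2.1 (Finset.mem_coe.1 hb)⟩, mem_cellsOf.2 (Finset.mem_coe.1 hb), ?_⟩
    · exact Or.inl (Subtype.ext hab)
    · exact Or.inr (adj_iff_wallAdjacent.2 hadj)
  · rintro hsep ⟨a, ha, b, hb, hab⟩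
    have h := hsep a.1 (Finset.mem_coe.2 (mem_cellsOf.1 ha)) b.1 (Finset.mem_coe.2 (mem_cellsOf.1 hb))
    exact hab.elim (fun e => h.1 (congrArg Subtype.val e)) fun e => h.2 (adj_iff_wallAdjacent.1 e)

/-- `IsCompatible (Touch B)` (polymer-gas form) = pairwise ζ-compatibility. [cite: Balaban1988RG2Cluster, (2.11) p.14] -/
theorem isCompatible_touch_iff [DecidableRel (Touch B)] (A : Finset (Dom B)) :
    IsCompatible (Touch B) A ↔ ∀ X ∈ A, ∀ X' ∈ A, X ≠ X' → WallSeparated (↑X.1 : Set (Pt d)) ↑X'.1 := by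
  constructor
  · intro h X hX X' hX' hne
    exact (not_touch_iff_wallSeparated B X X').1 (h (Finset.mem_coe.2 hX) (Finset.mem_coe.2 hX') hne)
  · intro h X hX X' hX' hne
    exact (not_touch_iff_wallSeparated B X X').2 (h X (Finset.mem_coe.1 hX) X' (Finset.mem_coe.1 hX') hne)

/-- Re-indexing the families of (2.11) by the finite type `Dom B`: `Σ_{F ∈ polymerFamilies B} Π_{K∈F} H K` is the
tree's polymer partition function `Ξ` of `(Dom B, Touch B)` with activities `X ↦ H X`. [cite: Balaban1988RG2Cluster, (2.11) p.14] -/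
theorem sum_polymerFamilies_eq_Z [DecidableEq (Dom B)] [DecidableRel (Touch B)] (H : Finset (Pt d) → ℂ) :
    ∑ F ∈ polymerFamilies B, ∏ K ∈ F, H K
      = polymerPartitionFunction (Touch B) (fun X : Dom B => H X.1) Finset.univ := by
  classical
  rw [polymerPartitionFunction_eq_sum_filter]
  refine Finset.sum_nbij' (fun F => F.subtype (IsDom B))
    (fun A => A.map (Function.Embedding.subtype _)) ?_ ?_ ?_ ?_ ?_
  · intro F hF
    obtain ⟨_, hsep⟩ := mem_polymerFamilies.1 hF
    refine Finset.mem_filter.2 ⟨Finset.mem_powerset.2 (Finset.subset_univ (α := Dom B) _), ?_⟩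
    refine (isCompatible_touch_iff B _).2 fun X hX X' hX' hne => ?_
    exact hsep (Finset.mem_coe.2 (Finset.mem_subtype.1 hX)) (Finset.mem_coe.2 (Finset.mem_subtype.1 hX'))
      (fun h => hne (Subtype.ext h))
  · intro A hA
    have hc := (isCompatible_touch_iff B A).1 (Finset.mem_filter.1 hA).2
    refine mem_polymerFamilies.2 ⟨fun K hK => ?_, fun K hK K' hK' hne => ?_⟩
    · obtain ⟨X, _, rfl⟩ := Finset.mem_map.1 hK
      exact X.2
    · obtain ⟨X, hX, rfl⟩ := Finset.mem_map.1 (Finset.mem_coe.1 hK)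
      obtain ⟨X', hX', rfl⟩ := Finset.mem_map.1 (Finset.mem_coe.1 hK')
      exact hc X hX X' hX' (fun h => hne (by rw [h]))
  · intro F hF
    exact Finset.subtype_map_of_mem fun K hK => (mem_polymerFamilies.1 hF).1 K hK
  · intro A _
    ext X
    rw [Finset.mem_subtype, Finset.mem_map]
    exact ⟨fun ⟨Y, hY, hYX⟩ => by rwa [← Subtype.ext hYX], fun hX => ⟨X, hX, rfl⟩⟩
  · intro F hF
    conv_lhs => rw [← Finset.subtype_map_of_mem (fun K hK => (mem_polymerFamilies.1 hF).1 K hK :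
      ∀ K ∈ F, IsDom B K)]
    rw [Finset.prod_map]
    rfl

/-- **(2.11) p. 14, FIRST EQUALITY (tree's set form)**: `Σ_{Z ⊆ B} Π_{Z_i component of Z} H(Z_i) = Ξ`, the polymer
partition function of the localization domains of `B` with the incompatibility «share a cube or a wall»
(`TreeLengthCubeSystem.Touch`, the `ι` of `TreeLengthCubeSystem.geometry B`). [cite: Balaban1988RG2Cluster, (2.11) p.14] -/
theorem first_eq_211 [DecidableEq (Dom B)] [DecidableRel (Touch B)] (H : Finset (Pt d) → ℂ) :
    ∑ Z ∈ B.powerset, ∏ K ∈ compsF Z, H K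
      = polymerPartitionFunction (Touch B) (fun X : Dom B => H X.1) Finset.univ :=
  (sum_powerset_prod_comps B H).trans (sum_polymerFamilies_eq_Z B H)

/-- **(2.9)–(2.10) ⇒ (2.11), first equality (tree's set form)** over `B13Factor210.Hsum`:
`Σ_{Z ⊆ B} H(Z) = Ξ(Dom B, Touch B, H)`. [cite: Balaban1988RG2Cluster, (2.11) p.14] -/
theorem sum_Hsum_eq_Z [DecidableEq (Dom B)] [DecidableRel (Touch B)]
    {adm : Finset (Pt d) → Finset (Pt d) → Prop} [∀ Z Z₀, Decidable (adm Z Z₀)]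
    {act : Finset (Pt d) → Finset (Pt d) → ℂ} (hadm : AdmLocal adm) (hact : ActMul adm act)
    (h0 : Hsum adm act ∅ = 1) :
    ∑ Z ∈ B.powerset, Hsum adm act Z
      = polymerPartitionFunction (Touch B) (fun X : Dom B => Hsum adm act X.1) Finset.univ := by
  rw [sum_Hsum_eq_sum_polymerFamilies hadm hact h0 B, sum_polymerFamilies_eq_Z]

open Classical in
/-- **The printed `ζ` of (2.11)** for the window catalogue `Dom B`: *"ζ(Z, Z′) = 0 if Z∩Z′ contains a cube, or a
wall of a cube, and ζ(Z, Z′) = 1 otherwise."* [cite: Balaban1988RG2Cluster, (2.11) p.14] -/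
noncomputable def zeta (Z Z' : Dom B) : ℝ := if Touch B Z Z' then 0 else 1

/-- `ζ = 1` iff the domains share no cube and no wall. [cite: Balaban1988RG2Cluster, (2.11) p.14] -/
theorem zeta_eq_one_iff {Z Z' : Dom B} : zeta B Z Z' = 1 ↔ ¬ Touch B Z Z' := by
  unfold zeta
  split_ifs with h <;> simp [h]

/-- `ζ` takes the values `0, 1`. [cite: Balaban1988RG2Cluster, (2.11) p.14] -/
theorem zeta_zero_or_one (Z Z' : Dom B) : zeta B Z Z' = 0 ∨ zeta B Z Z' = 1 := by
  unfold zeta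
  split_ifs <;> simp

/-- `ζ` is symmetric. [cite: Balaban1988RG2Cluster, (2.11) p.14] -/
theorem zeta_symm (Z Z' : Dom B) : zeta B Z Z' = zeta B Z' Z := by
  classical
  exact if_congr ⟨touch_symm B Z Z', touch_symm B Z' Z⟩ rfl rfl

/-- `ζ(Z, Z) = 0` (a domain contains a cube). [cite: Balaban1988RG2Cluster, (2.11) p.14] -/
theorem zeta_self (Z : Dom B) : zeta B Z Z = 0 := if_pos (touch_refl B Z)

/-- Printed `B13Sect2Statements.Compatible (zeta B)` = tree's `IsCompatible (Touch B)`. [cite: Balaban1988RG2Cluster, (2.11) p.14] -/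
theorem compatible_zeta_iff [DecidableRel (Touch B)] (A : Finset (Dom B)) :
    Compatible (zeta B) A ↔ IsCompatible (Touch B) A := by
  constructor
  · intro h X hX X' hX' hne
    exact (zeta_eq_one_iff B).1 (h X (Finset.mem_coe.1 hX) X' (Finset.mem_coe.1 hX') hne)
  · intro h X hX X' hX' hne
    exact (zeta_eq_one_iff B).2 (h (Finset.mem_coe.2 hX) (Finset.mem_coe.2 hX') hne)

/-- Printed `B13Sect2Statements.compatibleFamilySum (zeta B)` = tree's `Ξ(Dom B, Touch B)`. [cite: Balaban1988RG2Cluster, (2.11) p.14] -/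
theorem compatibleFamilySum_zeta [DecidableEq (Dom B)] [DecidableRel (Touch B)] (w : Dom B → ℂ) :
    compatibleFamilySum (zeta B) w = polymerPartitionFunction (Touch B) w Finset.univ := by
  unfold compatibleFamilySum
  rw [polymerPartitionFunction_eq_sum_filter]
  exact Finset.sum_congr (Finset.filter_congr fun A _ => compatible_zeta_iff B A) fun _ _ => rfl

/-- **(2.11) p. 14, FIRST EQUALITY (printed family form)**: `Σ_{Z ⊆ B} Π_{Z_i component of Z} H(Z_i) =
Σ_{{Z₁,…,Z_n}} H(Z₁)⋯H(Z_n)` (`B13Sect2Statements.compatibleFamilySum`, printed `ζ`). [cite: Balaban1988RG2Cluster, (2.11) p.14] -/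
theorem first_eq_211_printed (H : Finset (Pt d) → ℂ) :
    ∑ Z ∈ B.powerset, ∏ K ∈ compsF Z, H K = compatibleFamilySum (zeta B) (fun X : Dom B => H X.1) := by
  classical
  rw [compatibleFamilySum_zeta, first_eq_211]

/-- **(2.11) p. 14, BOTH EQUALITIES for the window**: `Σ_{Z ⊆ B} Π_{Z_i component of Z} H(Z_i) =
1 + Σ_{n≥1} (1/n!) Σ_{(Z₁,…,Z_n)} Π_{i<j} ζ(Z_i, Z_j) H(Z₁)⋯H(Z_n)` (second equality:
`B13Sect2Statements.polymerExpansion_211`, its hypotheses on `ζ` hold for `zeta B`). [cite: Balaban1988RG2Cluster, (2.11) p.14] -/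
theorem polymerExpansion_211_window (H : Finset (Pt d) → ℂ) :
    ∑ Z ∈ B.powerset, ∏ K ∈ compsF Z, H K = polymerSeries211 (zeta B) (fun X : Dom B => H X.1) := by
  rw [first_eq_211_printed, polymerExpansion_211 (zeta B) _ (zeta_zero_or_one B) (zeta_symm B) (zeta_self B)]

end Window

end Literature.MathematicalPhysics.QuantumFieldTheory.Balaban1983to89.B13Eq210Components
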